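import Summits.HodgeConjecture.CorCM.Census.TwistGenerationModel

/-!
# Uniform twist generation, III: THE NEAR-CLASS CALCULUS and the residual types

COR-CM (cell `pub-hodgecm2`), count-neutral kernel combinatorics by the binder seat b09 (gen 36; lane UNIFORM TWIST GENERATION, part III), on
parts I–II (`Census/TwistGenerationDescent.lean`: `descent`, `single_sub_thetaG_mem_of`; `Census/TwistGenerationModel.lean`: `cst`, `ddist`, `pot`,
`nearCl`) used BY NAME.  Theorems only: no definition, no `decide`, no certificate, no named fact, no `sorry`.
HONEST FRAMING: `HC_CM` is NOT proved, here or anywhere in the tree; nothing here is a period or a headline.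

Along a datum `θ : G ≃ ℤ/2n × B` (`θ (PQ) = θ P + θ Q`, `θ c = (n, 0)`):
* §1 the near-class calculus: flips move `ddist` by one, the triangle bound, base-change stability / uniqueness (`n ≥ 2`) / flip-closure of the near
  classes, distances between centres (`card_B_le_card_sdiff_cst`, `two_mul_card_B_le_card_sdiff_cst`) and the membership test `mem_nearCl_of_bounds`;
* §2 the residual types (`pot ≤ 1` = a centre or a single flip of a centre, `eq_cst_or_eq_oflipCM_of_pot_le_one`; their potentials; single flips
  of `cst 0` at arc points `i ≠ i'` lie in different blocks when `|B| ≥ 3`, `eq_of_blk_oflipCM_eq`).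
Part IV (`Census/TwistGenerationCover.lean`) builds the covering family on this calculus.

## References
* [Pohlmann1968] H. Pohlmann, Algebraic cycles on abelian varieties of complex multiplication type, Ann. of Math. 88 (1968), Thm 1.
* [Milne1999] J. S. Milne, Lefschetz motives and the Tate conjecture, Compositio Math. 117 (1999), Prop. 2.1, p. 54.
-/

namespace Summit.HodgeConjecture.CorCM.Census.TwistGeneration

open Finset
open Summit.HodgeConjecture.CorCM.Prior.AllgGroup.RfwfAllgGroup
open Summit.HodgeConjecture.CorCM.Census.BlockParity
open Summit.HodgeConjecture.CorCM.Census.Coinvariant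
open scoped symmDiff

noncomputable section

variable {G : Type*} [Group G] [Fintype G] [DecidableEq G] {c : G}
variable {B : Type} [AddGroup B]
variable {n : ℕ} [NeZero n] (θ : G ≃ ZMod (2 * n) × B)

/-! ## §1 The near-class calculus -/

section NearCalc

/-- **Flip law, non-deviation place**: flipping `Ψ` at `t ∉ Ψ` with `t ∉ T` raises `ddist T` by one. [folklore] -/
theorem ddist_oflipCM_of_not_mem (hc2 : c * c = 1) {T Ψ : CMF G c} {t : G} (htΨ : t ∉ Ψ.1) (htT : t ∉ T.1) :
    ddist T (oflipCM c hc2 t Ψ) = ddist T Ψ + 1 := by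
  unfold ddist
  have hct : c * t ∈ T.1 := by by_contra h; exact htT ((T.2 t).mpr h)
  have hctΨ : c * t ∈ Ψ.1 := by by_contra h; exact htΨ ((Ψ.2 t).mpr h)
  have hnot : c * t ∉ T.1 \ Ψ.1 := fun h => (mem_sdiff.mp h).2 hctΨ
  have h : T.1 \ (oflipCM c hc2 t Ψ).1 = insert (c * t) (T.1 \ Ψ.1) := by
    ext x
    rw [mem_insert, mem_sdiff, mem_sdiff, mem_oflipCM_iff' hc2, mem_orb, not_not]
    constructor
    · rintro ⟨hxT, hx⟩
      by_cases hxc : x = c * t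
      · exact Or.inl hxc
      · have hxt : x ≠ t := fun h => htT (h ▸ hxT)
        exact Or.inr ⟨hxT, fun hxΨ => by rcases hx.mp hxΨ with h | h <;> contradiction⟩
    · rintro (rfl | ⟨hxT, hxΨ⟩)
      · exact ⟨hct, iff_of_true hctΨ (Or.inr rfl)⟩
      · have hxt : x ≠ t := fun h => htT (h ▸ hxT)
        have hxc : x ≠ c * t := by rintro rfl; exact hnot (mem_sdiff.mpr ⟨hxT, hxΨ⟩)
        exact ⟨hxT, ⟨fun h => absurd h hxΨ, fun h => by rcases h with h | h <;> contradiction⟩⟩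
  rw [h, card_insert_of_notMem hnot]

/-- **Every flip changes `ddist T` by at most one (downwards).** [folklore] -/
theorem ddist_le_ddist_oflipCM_add_one (hc2 : c * c = 1) (T Ψ : CMF G c) (t : G) :
    ddist T Ψ ≤ ddist T (oflipCM c hc2 t Ψ) + 1 := by
  -- flip at `t` or at `c t`: reduce to a representative outside `Ψ`
  have key : ∀ s : G, s ∉ Ψ.1 → ddist T Ψ ≤ ddist T (oflipCM c hc2 s Ψ) + 1 := by
    intro s hs
    by_cases hsT : s ∈ T.1
    · rw [ddist_oflipCM_of_mem_sdiff hc2 (mem_sdiff.mpr ⟨hsT, hs⟩)]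
    · rw [ddist_oflipCM_of_not_mem hc2 hs hsT]; omega
  by_cases ht : t ∈ Ψ.1
  · have hct : c * t ∉ Ψ.1 := (Ψ.2 t).mp ht
    have e : oflipCM c hc2 t Ψ = oflipCM c hc2 (c * t) Ψ := by
      apply Subtype.ext
      change Ψ.1 ∆ orb c t = Ψ.1 ∆ orb c (c * t)
      congr 1
      ext x; rw [mem_orb, mem_orb, cmul_cmul c hc2]; tauto
    rw [e]; exact key _ hct
  · exact key _ ht


/-- **Triangle bound**: `|T' ∖ T| ≤ ddist T' Ψ + ddist T Ψ`. [folklore] -/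
theorem card_sdiff_le_ddist_add (hc2 : c * c = 1) (T T' Ψ : CMF G c) : (T'.1 \ T.1).card ≤ ddist T' Ψ + ddist T Ψ := by
  unfold ddist
  have hsub : T'.1 \ T.1 ⊆ (T'.1 \ Ψ.1) ∪ (T.1 \ Ψ.1).image (fun x => c * x) := by
    intro x hx
    rw [mem_sdiff] at hx
    rw [mem_union, mem_sdiff, mem_image]
    by_cases hxΨ : x ∈ Ψ.1
    · right
      refine ⟨c * x, mem_sdiff.mpr ⟨?_, (Ψ.2 x).mp hxΨ⟩, by rw [cmul_cmul c hc2]⟩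
      by_contra h; exact hx.2 ((T.2 x).mpr h)
    · exact Or.inl ⟨hx.1, hxΨ⟩
  refine (card_le_card hsub).trans ((card_union_le _ _).trans ?_)
  have := card_image_le (s := T.1 \ Ψ.1) (f := fun x => c * x)
  omega



variable (hθ : ∀ P Q : G, θ (P * Q) = θ P + θ Q) (hθc : θ c = (((n : ℕ) : ZMod (2 * n)), 0))

/-- On the near class the potential is the distance to the near centre. [folklore] -/
theorem pot_eq_of_near {a : ZMod (2 * n)} {Ψ : CMF G c} (h : Ψ ∈ nearCl θ hθ hθc a) : pot θ hθ hθc Ψ = ddist (cst θ hθ hθc a) Ψ := by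
  rw [mem_nearCl_iff] at h
  apply le_antisymm (pot_le θ hθ hθc Ψ a)
  obtain ⟨a', ha'⟩ := exists_pot_eq θ hθ hθc Ψ
  rw [ha']; exact (h a').1

/-- **The near class is base-change stable**: `Ψ ∈ nearCl a → Ψ·Q⁻¹ ∈ nearCl (a − (θQ).1)`. [folklore] -/
theorem near_rt {a : ZMod (2 * n)} {Ψ : CMF G c} (h : Ψ ∈ nearCl θ hθ hθc a) (Q : G) : rt c Q Ψ ∈ nearCl θ hθ hθc (a - (θ Q).1) := by
  rw [mem_nearCl_iff] at h ⊢
  intro a'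
  have e : ∀ x : ZMod (2 * n), ddist (cst θ hθ hθc x) (rt c Q Ψ) = ddist (cst θ hθ hθc (x + (θ Q).1)) Ψ := by
    intro x
    rw [show cst θ hθ hθc x = rt c Q (cst θ hθ hθc (x + (θ Q).1)) by rw [rt_cst, add_sub_cancel_right], ddist_rt]
  rw [e, e, sub_add_cancel]
  obtain ⟨h1, h2⟩ := h (a' + (θ Q).1)
  refine ⟨h1, fun hne hne' => h2 (fun h' => hne ?_) (fun h' => hne' ?_)⟩
  · rw [← h', add_sub_cancel_right]
  · linear_combination h'

/-- **The near index is unique** (`n ≥ 2`). [folklore] -/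
theorem near_unique (hn : 2 ≤ n) {a a' : ZMod (2 * n)} {Ψ : CMF G c} (h : Ψ ∈ nearCl θ hθ hθc a) (h' : Ψ ∈ nearCl θ hθ hθc a') :
    a = a' := by
  rw [mem_nearCl_iff] at h h'
  by_contra hne
  have h1 := (h a').1
  have h2 := (h' a).1
  by_cases ha : a' = a - 1
  · by_cases hb : a = a' - 1
    · have h3 : (2 : ZMod (2 * n)) = 0 := by
        have e : a = a - 1 - 1 := by rw [← ha]; exact hb
        linear_combination e
      have h4 := congrArg ZMod.val h3
      rw [ZMod.val_zero, show (2 : ZMod (2 * n)) = ((2 : ℕ) : ZMod (2 * n)) by norm_cast, ZMod.val_natCast,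
        Nat.mod_eq_of_lt (by omega)] at h4
      exact absurd h4 (by norm_num)
    · exact absurd h1 (not_le.mpr ((h' a).2 hne hb))
  · exact absurd h2 (not_le.mpr ((h a').2 (Ne.symm hne) ha))

/-- **Closure of the near class under deviation flips**: flipping `Ψ ∈ nearCl a` at a place of `cst a ∖ Ψ` stays in `nearCl a`. [folklore] -/
theorem near_oflipCM (hc2 : c * c = 1) {a : ZMod (2 * n)} {Ψ : CMF G c} (h : Ψ ∈ nearCl θ hθ hθc a) {t : G}
    (ht : t ∈ (cst θ hθ hθc a).1 \ Ψ.1) : oflipCM c hc2 t Ψ ∈ nearCl θ hθ hθc a := by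
  rw [mem_nearCl_iff] at h ⊢
  intro a'
  have hd := ddist_oflipCM_of_mem_sdiff hc2 ht
  have hd' := ddist_le_ddist_oflipCM_add_one hc2 (cst θ hθ hθc a') Ψ t
  obtain ⟨h1, h2⟩ := h a'
  refine ⟨by omega, fun hne hne' => ?_⟩
  have := h2 hne hne'
  omega


/-- Two successive deviation flips stay in the near class. [folklore] -/
theorem near_oflipCM_oflipCM (hc2 : c * c = 1) {a : ZMod (2 * n)} {Ψ : CMF G c} (h : Ψ ∈ nearCl θ hθ hθc a) {s s' : G}
    (hs : s ∈ (cst θ hθ hθc a).1 \ Ψ.1) (hs' : s' ∈ (cst θ hθ hθc a).1 \ Ψ.1) (hss' : s ≠ s') :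
    oflipCM c hc2 s (oflipCM c hc2 s' Ψ) ∈ nearCl θ hθ hθc a := by
  refine near_oflipCM θ hθ hθc hc2 (near_oflipCM θ hθ hθc hc2 h hs') ?_
  rw [dev_oflip c hc2 (mem_sdiff.mp hs').1 (mem_sdiff.mp hs').2]
  exact mem_erase.mpr ⟨hss', hs⟩

/-- `val` of a sum with a small natural number in `ℤ/2n`. [folklore] -/
theorem val_add_natCast (v : ZMod (2 * n)) {i : ℕ} (hi : i < 2 * n) :
    (v + (i : ZMod (2 * n))).val = if v.val + i < 2 * n then v.val + i else v.val + i - 2 * n := by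
  rw [ZMod.val_add, ZMod.val_natCast, Nat.mod_eq_of_lt hi]
  have hv := ZMod.val_lt v
  split_ifs with h
  · exact Nat.mod_eq_of_lt h
  · rw [Nat.mod_eq_sub_mod (by omega), Nat.mod_eq_of_lt (by omega)]

variable [Fintype B]

/-- **Distinct centres are far apart**: `|B| ≤ |cst a' ∖ cst a|` for `a' ≠ a` (one witness per column). [folklore] -/
theorem card_B_le_card_sdiff_cst {a a' : ZMod (2 * n)} (h : a' ≠ a) :
    Fintype.card B ≤ ((cst θ hθ hθc a').1 \ (cst θ hθ hθc a).1).card := by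
  -- the witness column point `θ⁻¹(a' + i, b)` with `i = n − v.val` (`v = a' − a`, `v.val ≤ n`) or `i = 0` (`v.val > n`)
  set v : ZMod (2 * n) := a' - a with hv
  have hv0 : v.val ≠ 0 := fun h0 => h (by
    have : v = 0 := by rw [← ZMod.val_eq_zero]; exact h0
    rw [hv, sub_eq_zero] at this; exact this)
  have hvlt := ZMod.val_lt v
  set i : ℕ := if v.val ≤ n then n - v.val else 0 with hi
  have hi_lt : i < n := by rw [hi]; split_ifs <;> omega
  have key : ∀ b : B, θ.symm (a' + i, b) ∈ (cst θ hθ hθc a').1 \ (cst θ hθ hθc a).1 := by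
    intro b
    rw [mem_sdiff, symm_mem_cst, symm_mem_cst, add_sub_cancel_left, ZMod.val_natCast, Nat.mod_eq_of_lt (by omega),
      show a' + (i : ZMod (2 * n)) - a = v + i by rw [hv]; ring, val_add_natCast v (by omega)]
    refine ⟨hi_lt, ?_⟩
    rw [hi]; split_ifs with h1 h2 h2 <;> omega
  calc Fintype.card B = (univ.image fun b : B => θ.symm (a' + i, b)).card := by
        rw [card_image_of_injective _ (fun b b' hb => by simpa using congrArg (fun P => (θ P).2) hb), card_univ]
    _ ≤ _ := card_le_card fun P hP => by
        obtain ⟨b, -, rfl⟩ := mem_image.mp hP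
        exact key b

/-- **Non-adjacent centres are twice as far apart**: `2|B| ≤ |cst a' ∖ cst a|` for `a' ∉ {a − 1, a, a + 1}` (two witnesses per column). [folklore] -/
theorem two_mul_card_B_le_card_sdiff_cst {a a' : ZMod (2 * n)} (h : a' ≠ a) (h₁ : a' ≠ a + 1) (h₂ : a' ≠ a - 1) :
    2 * Fintype.card B ≤ ((cst θ hθ hθc a').1 \ (cst θ hθ hθc a).1).card := by
  set v : ZMod (2 * n) := a' - a with hv
  have hvlt := ZMod.val_lt v
  have hv0 : v.val ≠ 0 := fun h0 => h (by
    have : v = 0 := by rw [← ZMod.val_eq_zero]; exact h0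
    rw [hv, sub_eq_zero] at this; exact this)
  have hv1 : v.val ≠ 1 := fun h0 => h₁ (by
    have : v = 1 := by
      apply ZMod.val_injective
      rw [h0, show (1 : ZMod (2 * n)) = ((1 : ℕ) : ZMod (2 * n)) by norm_cast, ZMod.val_natCast,
        Nat.mod_eq_of_lt (by have := NeZero.ne n; omega)]
    rw [hv, sub_eq_iff_eq_add, add_comm] at this; exact this)
  have h1val : (1 : ZMod (2 * n)).val = 1 := by
    rw [show (1 : ZMod (2 * n)) = ((1 : ℕ) : ZMod (2 * n)) by norm_cast, ZMod.val_natCast,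
      Nat.mod_eq_of_lt (by have := NeZero.ne n; omega)]
  have h1ne : (1 : ZMod (2 * n)) ≠ 0 := fun h0 => by
    have h0' := congrArg ZMod.val h0
    rw [h1val, ZMod.val_zero] at h0'
    exact one_ne_zero h0'
  have hv2 : v.val ≠ 2 * n - 1 := fun h0 => h₂ (by
    have : v = -1 := by
      apply ZMod.val_injective
      rw [h0, ZMod.neg_val, if_neg h1ne, h1val]
    rw [hv, sub_eq_iff_eq_add] at this; rw [this]; ring)
  -- two witnesses per column: offsets `i₀`, `i₀ + 1`
  set i₀ : ℕ := if v.val ≤ n then n - v.val else 0 with hi₀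
  have hi₀_lt : i₀ + 1 < n := by rw [hi₀]; split_ifs <;> omega
  have key : ∀ (e : ℕ), e ≤ 1 → ∀ b : B, θ.symm (a' + ((i₀ + e : ℕ) : ZMod (2 * n)), b) ∈ (cst θ hθ hθc a').1 \ (cst θ hθ hθc a).1 := by
    intro e he b
    rw [mem_sdiff, symm_mem_cst, symm_mem_cst, add_sub_cancel_left, ZMod.val_natCast, Nat.mod_eq_of_lt (by omega),
      show a' + ((i₀ + e : ℕ) : ZMod (2 * n)) - a = v + ((i₀ + e : ℕ) : ZMod (2 * n)) by rw [hv]; ring,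
      val_add_natCast v (by omega)]
    refine ⟨by omega, ?_⟩
    rw [hi₀]; split_ifs with h1 h2 h2 <;> omega
  set W : Finset G := (univ : Finset (Fin 2 × B)).image fun eb => θ.symm (a' + ((i₀ + eb.1 : ℕ) : ZMod (2 * n)), eb.2) with hW
  have hWcard : W.card = 2 * Fintype.card B := by
    rw [hW, card_image_of_injective, card_univ, Fintype.card_prod, Fintype.card_fin]
    rintro ⟨e, b⟩ ⟨e', b'⟩ hh
    change θ.symm (a' + ((i₀ + (e : ℕ) : ℕ) : ZMod (2 * n)), b) = θ.symm (a' + ((i₀ + (e' : ℕ) : ℕ) : ZMod (2 * n)), b') at hh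
    have hh' := congrArg θ hh
    simp only [Equiv.apply_symm_apply, Prod.mk.injEq, add_right_inj] at hh'
    obtain ⟨h1, h2⟩ := hh'
    have he := e.isLt
    have he' := e'.isLt
    have h3 := congrArg ZMod.val h1
    rw [ZMod.val_natCast, ZMod.val_natCast, Nat.mod_eq_of_lt (by omega), Nat.mod_eq_of_lt (by omega)] at h3
    have hee : e = e' := Fin.ext (by omega)
    rw [hee, h2]
  rw [← hWcard]
  refine card_le_card fun P hP => ?_
  obtain ⟨⟨e, b⟩, -, rfl⟩ := mem_image.mp hP
  exact key e (by omega) b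

/-- **Membership test for the near class**: `a` is near to `Φ` as soon as `ddist (cst a) Φ < |B|`, the next centre `a + 1` is strictly farther and
the previous centre `a − 1` is not nearer. [folklore] -/
theorem mem_nearCl_of_bounds (hc2 : c * c = 1) {a : ZMod (2 * n)} {Φ : CMF G c} (hd : ddist (cst θ hθ hθc a) Φ < Fintype.card B)
    (h₁ : ddist (cst θ hθ hθc a) Φ < ddist (cst θ hθ hθc (a + 1)) Φ) (h₂ : ddist (cst θ hθ hθc a) Φ ≤ ddist (cst θ hθ hθc (a - 1)) Φ) :
    Φ ∈ nearCl θ hθ hθc a := by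
  rw [mem_nearCl_iff]
  intro a'
  by_cases h0 : a' = a
  · subst h0; exact ⟨le_rfl, fun h _ => absurd rfl h⟩
  by_cases ha1 : a' = a + 1
  · subst ha1; exact ⟨h₁.le, fun _ _ => h₁⟩
  by_cases ha2 : a' = a - 1
  · subst ha2; exact ⟨h₂, fun _ h => absurd rfl h⟩
  have hfar := two_mul_card_B_le_card_sdiff_cst θ hθ hθc h0 ha1 ha2
  have htri := card_sdiff_le_ddist_add hc2 (cst θ hθ hθc a) (cst θ hθ hθc a') Φ
  exact ⟨by omega, fun _ _ => by omega⟩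

end NearCalc

/-! ## §2 The residual types -/

section Residual

variable (hθ : ∀ P Q : G, θ (P * Q) = θ P + θ Q) (hθc : θ c = (((n : ℕ) : ZMod (2 * n)), 0))

/-- A single flip of a centre at one of its own points deviates from it exactly there. [folklore] -/
theorem sdiff_oflipCM_cst (hc2 : c * c = 1) {a : ZMod (2 * n)} {t : G} (ht : t ∈ (cst θ hθ hθc a).1) :
    (cst θ hθ hθc a).1 \ (oflipCM c hc2 t (cst θ hθ hθc a)).1 = {t} := by
  have hct : c * t ∉ (cst θ hθ hθc a).1 := ((cst θ hθ hθc a).2 _).mp ht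
  ext y
  rw [mem_sdiff, mem_oflipCM_iff' hc2, mem_orb, mem_singleton]
  constructor
  · rintro ⟨hy, hy'⟩
    rw [not_not] at hy'
    rcases hy'.mp hy with h | h
    · exact h
    · exact absurd hy (h ▸ hct)
  · rintro rfl
    exact ⟨ht, not_not.mpr (iff_of_true ht (Or.inl rfl))⟩

/-- **The residual types**: a type of potential `≤ 1` is a centre or a single flip of a centre at one of its points. [folklore] -/
theorem eq_cst_or_eq_oflipCM_of_pot_le_one (hc2 : c * c = 1) {Ψ : CMF G c} (h : pot θ hθ hθc Ψ ≤ 1) :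
    ∃ a : ZMod (2 * n), Ψ = cst θ hθ hθc a ∨ ∃ t ∈ (cst θ hθ hθc a).1, Ψ = oflipCM c hc2 t (cst θ hθ hθc a) := by
  obtain ⟨a, ha⟩ := exists_pot_eq θ hθ hθc Ψ
  refine ⟨a, ?_⟩
  rw [ha, ddist] at h
  rcases Nat.le_one_iff_eq_zero_or_eq_one.mp h with h0 | h1
  · exact Or.inl (eq_of_dev_empty c (card_eq_zero.mp h0))
  · obtain ⟨t, ht⟩ := card_eq_one.mp h1
    exact Or.inr ⟨t, (mem_sdiff.mp (ht ▸ mem_singleton_self t)).1, eq_oflip_of_dev_singleton c hc2 ht⟩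

/-- The potential of a centre is `0`. [folklore] -/
theorem pot_cst (a : ZMod (2 * n)) : pot θ hθ hθc (cst θ hθ hθc a) = 0 :=
  Nat.eq_zero_of_le_zero (le_of_le_of_eq (pot_le θ hθ hθc _ a) (ddist_self _))

variable [Fintype B]

/-- The potential of a single flip of a centre is `1` (`|B| ≥ 2`). [folklore] -/
theorem pot_oflipCM_cst (hc2 : c * c = 1) (hB : 2 ≤ Fintype.card B) {a : ZMod (2 * n)} {t : G} (ht : t ∈ (cst θ hθ hθc a).1) :
    pot θ hθ hθc (oflipCM c hc2 t (cst θ hθ hθc a)) = 1 := by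
  have h1 : ddist (cst θ hθ hθc a) (oflipCM c hc2 t (cst θ hθ hθc a)) = 1 := by
    rw [ddist, sdiff_oflipCM_cst θ hθ hθc hc2 ht, card_singleton]
  apply le_antisymm (h1 ▸ pot_le θ hθ hθc _ a)
  obtain ⟨a', ha'⟩ := exists_pot_eq θ hθ hθc (oflipCM c hc2 t (cst θ hθ hθc a))
  rw [ha']
  by_contra hlt
  push Not at hlt
  have h0 : ddist (cst θ hθ hθc a') (oflipCM c hc2 t (cst θ hθ hθc a)) = 0 := by omega
  by_cases haa : a' = a
  · rw [haa, h1] at h0; exact one_ne_zero h0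
  · have := card_B_le_card_sdiff_cst θ hθ hθc haa
    have := card_sdiff_le_ddist_add hc2 (cst θ hθ hθc a) (cst θ hθ hθc a') (oflipCM c hc2 t (cst θ hθ hθc a))
    omega

/-- **Residual blocks are distinct**: single flips of `cst 0` at `θ⁻¹(i, b)` and `θ⁻¹(i', b')` with `i, i'` in the arc lie in one block only if
`i = i'` (`|B| ≥ 3`). [folklore] -/
theorem eq_of_blk_oflipCM_eq (hc2 : c * c = 1) (hB : 3 ≤ Fintype.card B) {i i' : ZMod (2 * n)} (hi : i.val < n) (hi' : i'.val < n)
    {b b' : B} (h : blk c (oflipCM c hc2 (θ.symm (i, b)) (cst θ hθ hθc 0)) = blk c (oflipCM c hc2 (θ.symm (i', b')) (cst θ hθ hθc 0))) :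
    i = i' := by
  have hti : θ.symm (i, b) ∈ (cst θ hθ hθc 0).1 := by rw [symm_mem_cst, sub_zero]; exact hi
  have hti' : θ.symm (i', b') ∈ (cst θ hθ hθc 0).1 := by rw [symm_mem_cst, sub_zero]; exact hi'
  obtain ⟨Q, hQ⟩ := exists_rt_eq_of_blk_eq c h
  rw [rt_oflipCM, rt_cst, zero_sub] at hQ
  -- the translated flip is within distance one of `cst (−k)` and of `cst 0`
  have hd1 : ddist (cst θ hθ hθc (-(θ Q).1)) (oflipCM c hc2 (θ.symm (i', b')) (cst θ hθ hθc 0)) = 1 := by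
    rw [← hQ, ← zero_sub, ← rt_cst θ hθ hθc Q 0, ← rt_oflipCM, ddist_rt, ddist, sdiff_oflipCM_cst θ hθ hθc hc2 hti, card_singleton]
  have hd0 : ddist (cst θ hθ hθc 0) (oflipCM c hc2 (θ.symm (i', b')) (cst θ hθ hθc 0)) = 1 := by
    rw [ddist, sdiff_oflipCM_cst θ hθ hθc hc2 hti', card_singleton]
  have hk : -(θ Q).1 = 0 := by
    by_contra hk
    have := card_B_le_card_sdiff_cst θ hθ hθc (a := (0 : ZMod (2 * n))) (a' := -(θ Q).1) hk
    have := card_sdiff_le_ddist_add hc2 (cst θ hθ hθc 0) (cst θ hθ hθc (-(θ Q).1)) (oflipCM c hc2 (θ.symm (i', b')) (cst θ hθ hθc 0))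
    omega
  rw [hk] at hQ
  -- same flip of the same centre: the deviation places coincide
  have hdev := sdiff_oflipCM_cst θ hθ hθc hc2 hti'
  have hmem : θ.symm (i, b) * Q⁻¹ ∈ (cst θ hθ hθc 0).1 := by
    rw [mem_cst, hθ, map_inv_eq θ hθ, Equiv.apply_symm_apply, Prod.fst_add, Prod.fst_neg, sub_zero,
      show i + -(θ Q).1 = -(θ Q).1 + i by ring, hk, zero_add]; exact hi
  rw [← hQ, sdiff_oflipCM_cst θ hθ hθc hc2 hmem] at hdev
  have heq : θ.symm (i, b) * Q⁻¹ = θ.symm (i', b') := singleton_injective hdev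
  have h2 := congrArg (fun P => (θ P).1) heq
  simp only [hθ, map_inv_eq θ hθ, Equiv.apply_symm_apply, Prod.fst_add, Prod.fst_neg] at h2
  rw [show i + -(θ Q).1 = -(θ Q).1 + i by ring, hk, zero_add] at h2
  exact h2

end Residual

end

end Summit.HodgeConjecture.CorCM.Census.TwistGeneration
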